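import Mathlib
import Summits.QuantumFields.BalabanUV.Beta.ThinLoopHolonomy

/-!
# Beta / MonotoneLoopHolonomy — THE AREA LAW FOR MONOTONE LOOPS (MODEL): two monotone staircase contours between the
# same endpoints (positive lattice words that are permutations of each other) have holonomies within `(|w| choose 2)·α`
# of each other when every plaquette inside a box containing them is within `α` of `1` — one adjacent transposition of
# steps = one conjugated plaquette (b07's `hol_plaqWord_eq`), and `|w| choose 2` transpositions sort any word.  This is the
# «straight-vs-recursive loop, area ≤ C_ν n²» input of the TWO-TRANSPORT form of E-I3 (row-D4 owner's RULING R-an4-40-1 (c)∕(d);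
# d4-p3's `CoarseCoerciveTransportPair.coarse_coercive_cov₂` p222847), consumed by this unit's `CovariantPlateauBlocksPair`
# (unit `b2b-balaban-beta-d4-p2`, GEN 6, MODEL crew; claim «E-I3-COV-PAIR» journal l.16069)

HONEST FRAMING: discharging `BetaPertH` makes Bałaban's UV stability UNCONDITIONAL — NOT the continuum limit, NOT the
Clay problem.  HONEST DEPENDENCY (verbatim): «continuum YM on T⁴ ⇐ BetaPertH ∧ nine spine estimates (0/9 proved);
BetaPertH ⇐ (D1) ∧ (D4) ∧ CAP+tail; G-an2-4 gates asym, D1 and NE2/3/4.»  THIS MODULE DISCHARGES NOTHING of `BetaPertH`,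
asserts NOTHING printed and cites nothing as a fact (ABSOLUTE RULE): [folklore] group∕normed-ring algebra about MODEL
OBJECTS on `ℤ^d` (b07's words, transports, plaquettes, clamped extensions — `B7Prop1Explicit`, `B7Prop1Local` BY NAME);
nothing of Bałaban's operators instantiated.  SHAPES located at [B9] = `Balaban1985BackgroundPropagators` (3.55) p. 401
(the recursive contours `Γ^{(j)}_{y,x}` through the nested block centres — read as image by d4-p3-g6 and the owner
2026-08-20, journal l.15742∕l.15847) and (3.35) p. 396.  No class change on row D4 or G-B9-15 (width 0; D4 DISCHARGE NO
DATE); NOT BetaPertH, NOT continuum, NOT Clay, NOT summit progress.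

CONTENT (kernel, 0 sorry).  §1 positive words `posWord u` (`u : List (Fin d)`), `hol_posWord_cons`, displacement ≥ 0 and
permutation-invariant.  §2 U1 algebra: the triangle inequality for `‖AC⁻¹ − 1‖`, one ADJACENT TRANSPOSITION = one plaquette
(`hol_swap_mul_inv`), common first letter = conjugation.  §3 **`norm_moveFront_le`** (moving a letter past `u` costs
`|u|·α`) and **`norm_hol_posWord_perm_le`** (two positive words that are permutations of each other: `≤ (|w| choose 2)·α`,
global plaquette bound).  §4 LOCALITY `hol_posWord_congr` (monotone words stay in any box containing their endpoints) and
the LOCAL form **`norm_hol_posWord_perm_le_of_plaquettes`** (plaquettes INSIDE the box only, via b07's `clampCfg`).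
§5 non-vacuity.  PRIOR ART (searched 2026-08-20, `lean search 'ladder_bound|posWord|monotone.*hol|area law|Perm.*hol'`):
b07's `ladder_bound`∕`axial_bond_bound` (thin ladders only), this unit's `ThinLoopHolonomy` (thin loops),
`B12Plaquette343.norm_holonomy_sub_one_le_of_size_le` (exponential-size form for a product of exponentials, no
combinatorics of contours); no area law for general monotone loops in the tree.
-/

namespace Summit.QuantumFields.BalabanUV.Beta.MonotoneLoopHolonomy

open Literature.MathematicalPhysics.QuantumFieldTheory.Balaban1983to89.B7Prop1Explicit
open Literature.MathematicalPhysics.QuantumFieldTheory.Balaban1983to89.B7Prop1Local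
open Literature.MathematicalPhysics.QuantumFieldTheory.Balaban1983to89 (B8Ineq170.norm_mul_sub_one_le_of_norm_le_one)
open Literature.MathematicalPhysics.QuantumFieldTheory.Balaban1983to89.B7Prop2Explicit (hol_plaqWord_self)

variable {d : ℕ}

/-! ## §1 Positive (monotone) words -/

/-- The POSITIVE word of a list of directions: the monotone staircase contour taking the steps `+e_{u₁}, +e_{u₂}, …`.
[folklore] -/
def posWord (u : List (Fin d)) : List (Letter d) := u.map fun κ => (κ, true)

/-- `posWord [] = []`. [folklore] -/
@[simp] theorem posWord_nil : posWord ([] : List (Fin d)) = [] := rfl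

/-- `posWord (κ :: u) = (κ, +) :: posWord u`. [folklore] -/
@[simp] theorem posWord_cons (κ : Fin d) (u : List (Fin d)) : posWord (κ :: u) = (κ, true) :: posWord u := rfl

/-- `posWord (u ++ v) = posWord u ++ posWord v`. [folklore] -/
@[simp] theorem posWord_append (u v : List (Fin d)) : posWord (u ++ v) = posWord u ++ posWord v := by
  simp [posWord]

/-- `|posWord u| = |u|`. [folklore] -/
@[simp] theorem length_posWord (u : List (Fin d)) : (posWord u).length = u.length := by simp [posWord]

/-- The displacement of a positive word is permutation invariant. [folklore] -/
theorem disp_posWord_perm {u₁ u₂ : List (Fin d)} (h : u₁.Perm u₂) : disp (posWord u₁) = disp (posWord u₂) := by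
  unfold disp posWord
  rw [List.map_map, List.map_map]
  exact (h.map _).sum_eq

/-- The displacement of a positive word is componentwise nonnegative. [folklore] -/
theorem disp_posWord_nonneg : ∀ (u : List (Fin d)) (i : Fin d), 0 ≤ disp (posWord u) i
  | [], i => by simp
  | κ :: u, i => by
    rw [posWord_cons, disp_cons, Pi.add_apply, Letter.vec_true, e_apply]
    have := disp_posWord_nonneg u i
    split_ifs <;> omega

section Group

variable {G : Type*} [Group G]

/-- Transport along a positive word, one step: `V(posWord (κ :: u)) = V(x, κ) · V_{x + e_κ}(posWord u)`. [folklore] -/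
theorem hol_posWord_cons (V : Site d → Fin d → G) (x : Site d) (κ : Fin d) (u : List (Fin d)) :
    hol V x (posWord (κ :: u)) = V x κ * hol V (x + e κ) (posWord u) := by
  rw [posWord_cons, hol_cons, stepHol_true, Letter.vec_true]

/-- **ONE ADJACENT TRANSPOSITION = ONE PLAQUETTE**: `V(i j u)·V(j i u)⁻¹ = V(∂p_{ij}(x))`. [cite: Balaban1985Averaging, (9) p.18] -/
theorem hol_swap_mul_inv (V : Site d → Fin d → G) (x : Site d) (i j : Fin d) (u : List (Fin d)) :
    hol V x (posWord (i :: j :: u)) * (hol V x (posWord (j :: i :: u)))⁻¹ = hol V x (plaqWord i j) := by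
  rw [hol_posWord_cons, hol_posWord_cons, hol_posWord_cons, hol_posWord_cons, hol_plaqWord_eq,
    show x + e j + e i = x + e i + e j by abel]
  group

/-- A common first letter conjugates: `V(a u)·V(a u′)⁻¹ = V(x,a)·[V(u)V(u′)⁻¹]·V(x,a)⁻¹`. [folklore] -/
theorem hol_cons_mul_inv (V : Site d → Fin d → G) (x : Site d) (a : Fin d) (u u' : List (Fin d)) :
    hol V x (posWord (a :: u)) * (hol V x (posWord (a :: u')))⁻¹ =
      V x a * (hol V (x + e a) (posWord u) * (hol V (x + e a) (posWord u'))⁻¹) * (V x a)⁻¹ := by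
  rw [hol_posWord_cons, hol_posWord_cons]
  group

end Group

/-! ## §2 Norm-≤-1 units: triangle inequality for `‖AC⁻¹ − 1‖` -/

section Normed

variable {𝔸 : Type*} [NormedRing 𝔸] [NormOneClass 𝔸]

/-- `‖AC⁻¹ − 1‖ ≤ ‖AB⁻¹ − 1‖ + ‖BC⁻¹ − 1‖` for `B, C ∈ U1` (`AC⁻¹ − 1 = (AB⁻¹ − 1)BC⁻¹ + (BC⁻¹ − 1)`). [folklore] -/
theorem norm_mul_inv_sub_one_triangle (A : 𝔸ˣ) {B C : 𝔸ˣ} (hB : B ∈ U1 𝔸) (hC : C ∈ U1 𝔸) :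
    ‖((A * C⁻¹ : 𝔸ˣ) : 𝔸) - 1‖ ≤ ‖((A * B⁻¹ : 𝔸ˣ) : 𝔸) - 1‖ + ‖((B * C⁻¹ : 𝔸ˣ) : 𝔸) - 1‖ := by
  have hid : ((A * C⁻¹ : 𝔸ˣ) : 𝔸) - 1 =
      (((A * B⁻¹ : 𝔸ˣ) : 𝔸) - 1) * ((B * C⁻¹ : 𝔸ˣ) : 𝔸) + (((B * C⁻¹ : 𝔸ˣ) : 𝔸) - 1) := by
    simp only [Units.val_mul, sub_mul, one_mul]
    rw [show (A : 𝔸) * ((B⁻¹ : 𝔸ˣ) : 𝔸) * ((B : 𝔸) * ((C⁻¹ : 𝔸ˣ) : 𝔸)) = (A : 𝔸) * ((C⁻¹ : 𝔸ˣ) : 𝔸) by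
      rw [mul_assoc, ← mul_assoc ((B⁻¹ : 𝔸ˣ) : 𝔸), Units.inv_mul, one_mul]]
    abel
  have hBC : ‖((B * C⁻¹ : 𝔸ˣ) : 𝔸)‖ ≤ 1 := ((U1 𝔸).mul_mem hB ((U1 𝔸).inv_mem hC)).1
  rw [hid]
  calc _ ≤ ‖(((A * B⁻¹ : 𝔸ˣ) : 𝔸) - 1) * ((B * C⁻¹ : 𝔸ˣ) : 𝔸)‖ + ‖((B * C⁻¹ : 𝔸ˣ) : 𝔸) - 1‖ := norm_add_le _ _
    _ ≤ ‖((A * B⁻¹ : 𝔸ˣ) : 𝔸) - 1‖ * ‖((B * C⁻¹ : 𝔸ˣ) : 𝔸)‖ + ‖((B * C⁻¹ : 𝔸ˣ) : 𝔸) - 1‖ := by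
        gcongr; exact norm_mul_le _ _
    _ ≤ ‖((A * B⁻¹ : 𝔸ˣ) : 𝔸) - 1‖ * 1 + ‖((B * C⁻¹ : 𝔸ˣ) : 𝔸) - 1‖ := by gcongr
    _ = _ := by rw [mul_one]

/-! ## §3 Move-to-front and the area law for positive words (global plaquette bound) -/

variable {V : Site d → Fin d → 𝔸ˣ}

/-- **MOVING A LETTER TO THE FRONT COSTS `|u|` PLAQUETTES**: `‖V(u a v)·V(a u v)⁻¹ − 1‖ ≤ |u|·α`. [folklore] -/
theorem norm_moveFront_le (hV : ∀ x κ, V x κ ∈ U1 𝔸) {α : ℝ}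
    (hP : ∀ (z : Site d) (i j : Fin d), ‖((hol V z (plaqWord i j) : 𝔸ˣ) : 𝔸) - 1‖ ≤ α) :
    ∀ (u : List (Fin d)) (a : Fin d) (v : List (Fin d)) (x : Site d),
      ‖((hol V x (posWord (u ++ a :: v)) * (hol V x (posWord (a :: (u ++ v))))⁻¹ : 𝔸ˣ) : 𝔸) - 1‖ ≤ u.length * α
  | [], a, v, x => by simp
  | b :: u, a, v, x => by
    rw [List.cons_append, List.length_cons, Nat.cast_succ, add_mul, one_mul]
    have hB : hol V x (posWord (b :: a :: (u ++ v))) ∈ U1 𝔸 := hol_mem hV _ _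
    have hC : hol V x (posWord (a :: (b :: u ++ v))) ∈ U1 𝔸 := hol_mem hV _ _
    refine (norm_mul_inv_sub_one_triangle _ hB hC).trans (add_le_add ?_ ?_)
    · -- common first letter `b`: conjugation of the inductive case
      rw [hol_cons_mul_inv, Units.val_mul, Units.val_mul]
      exact (norm_units_conj_sub_one_le (hV x b) _).trans (norm_moveFront_le hV hP u a v (x + e b))
    · -- the adjacent transposition `b a → a b`
      rw [List.cons_append, hol_swap_mul_inv]
      exact hP x b a

/-- **THE AREA LAW FOR MONOTONE LOOPS (global form)**: two positive words that are permutations of each other have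
holonomies with `‖V(w₁)·V(w₂)⁻¹ − 1‖ ≤ (|w₁| choose 2)·α`, `α` a bound on ALL plaquette defects `‖V(∂p) − 1‖`. [folklore] -/
theorem norm_hol_posWord_perm_le (hV : ∀ x κ, V x κ ∈ U1 𝔸) {α : ℝ} (hα : 0 ≤ α)
    (hP : ∀ (z : Site d) (i j : Fin d), ‖((hol V z (plaqWord i j) : 𝔸ˣ) : 𝔸) - 1‖ ≤ α) :
    ∀ (w₁ w₂ : List (Fin d)), w₁.Perm w₂ → ∀ x : Site d,
      ‖((hol V x (posWord w₁) * (hol V x (posWord w₂))⁻¹ : 𝔸ˣ) : 𝔸) - 1‖ ≤ (w₁.length.choose 2 : ℕ) * α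
  | [], w₂, h, x => by
    have h0 := h.nil_eq
    subst h0
    simp
  | a :: w₁, w₂, h, x => by
    obtain ⟨u, v, rfl⟩ := List.append_of_mem (h.subset List.mem_cons_self)
    have h' : w₁.Perm (u ++ v) := (h.trans List.perm_middle).cons_inv
    have hlen : u.length ≤ w₁.length := by
      have := h'.length_eq
      rw [List.length_append] at this
      omega
    have hB : hol V x (posWord (a :: (u ++ v))) ∈ U1 𝔸 := hol_mem hV _ _
    have hC : hol V x (posWord (u ++ a :: v)) ∈ U1 𝔸 := hol_mem hV _ _
    rw [List.length_cons, Nat.choose_succ_succ, Nat.choose_one_right, Nat.cast_add, add_mul,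
      add_comm ((w₁.length : ℝ) * α)]
    refine (norm_mul_inv_sub_one_triangle _ hB hC).trans (add_le_add ?_ ?_)
    · rw [hol_cons_mul_inv, Units.val_mul, Units.val_mul]
      exact (norm_units_conj_sub_one_le (hV x a) _).trans (norm_hol_posWord_perm_le hV hα hP w₁ (u ++ v) h' (x + e a))
    · have hmf := norm_moveFront_le hV hP u a v x
      have hX : hol V x (posWord (u ++ a :: v)) * (hol V x (posWord (a :: (u ++ v))))⁻¹ ∈ U1 𝔸 :=
        (U1 𝔸).mul_mem hC ((U1 𝔸).inv_mem hB)
      have hinv : (hol V x (posWord (a :: (u ++ v))) * (hol V x (posWord (u ++ a :: v)))⁻¹) =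
          (hol V x (posWord (u ++ a :: v)) * (hol V x (posWord (a :: (u ++ v))))⁻¹)⁻¹ := by
        rw [mul_inv_rev, inv_inv]
      rw [hinv]
      calc _ ≤ _ := norm_inv_sub_one_le hX
        _ ≤ u.length * α := hmf
        _ ≤ w₁.length * α := mul_le_mul_of_nonneg_right (by exact_mod_cast hlen) hα

/-! ## §4 Locality and the local form (plaquettes inside a box only) -/

/-- A point between two points of a box (componentwise) lies in the box — here: the first step of a monotone word whose
endpoints lie in the box. [folklore] -/
theorem inBox_step {lo hi x : Site d} (hx : InBox lo hi x) (κ : Fin d) (u : List (Fin d))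
    (hend : InBox lo hi (x + disp (posWord (κ :: u)))) : InBox lo hi (x + e κ) := fun i => by
  have h1 := hx i
  have h2 := hend i
  have h3 := disp_posWord_nonneg u i
  simp only [posWord_cons, disp_cons, Letter.vec_true, Pi.add_apply, e_apply] at h2 ⊢
  split_ifs at h2 ⊢ <;> omega

omit [NormOneClass 𝔸] in
/-- **LOCALITY**: configurations agreeing on the bonds of a box have the same transport along every monotone word whose
endpoints lie in the box. [folklore] -/
theorem hol_posWord_congr {lo hi : Site d} {V V' : Site d → Fin d → 𝔸ˣ} (h : AgreeOn lo hi V V') :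
    ∀ (u : List (Fin d)) (x : Site d), InBox lo hi x → InBox lo hi (x + disp (posWord u)) →
      hol V x (posWord u) = hol V' x (posWord u)
  | [], x, _, _ => by simp
  | κ :: u, x, hx, hend => by
    have hxe : InBox lo hi (x + e κ) := inBox_step hx κ u hend
    have hend' : InBox lo hi (x + e κ + disp (posWord u)) := by
      simpa [posWord_cons, disp_cons, add_assoc] using hend
    rw [hol_posWord_cons, hol_posWord_cons, h x κ hx hxe, hol_posWord_congr h u (x + e κ) hxe hend']

/-- **THE AREA LAW FOR MONOTONE LOOPS (local form)**: if every plaquette of `V` INSIDE the box `[lo, hi]` is within `α`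
of `1`, then for two positive words that are permutations of each other, starting at `x ∈ [lo, hi]` and ending in the
box, `‖V(w₁)·V(w₂)⁻¹ − 1‖ ≤ (|w₁| choose 2)·α` — the loop «straight contour vs recursive contour» of the two-transport
E-I3 (owner's RULING R-an4-40-1 (c), d4-p3's F-d4p3-16) is of this kind. [cite: Balaban1985BackgroundPropagators, (3.55) p.401] -/
theorem norm_hol_posWord_perm_le_of_plaquettes {lo hi : Site d} (hlohi : ∀ i, lo i ≤ hi i)
    (V : Site d → Fin d → 𝔸ˣ) (hV : ∀ x κ, V x κ ∈ U1 𝔸) {α : ℝ} (hα : 0 ≤ α)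
    (h44 : ∀ (z : Site d) (κ μ : Fin d), κ ≠ μ → PlaqIn lo hi (z, κ, μ) →
      ‖((hol V z (plaqWord κ μ) : 𝔸ˣ) : 𝔸) - 1‖ ≤ α)
    {x : Site d} (hx : InBox lo hi x) {w₁ w₂ : List (Fin d)} (hperm : w₁.Perm w₂)
    (hend : InBox lo hi (x + disp (posWord w₁))) :
    ‖((hol V x (posWord w₁) * (hol V x (posWord w₂))⁻¹ : 𝔸ˣ) : 𝔸) - 1‖ ≤ (w₁.length.choose 2 : ℕ) * α := by
  set W := clampCfg lo hi V with hW
  have hWm : ∀ x κ, W x κ ∈ U1 𝔸 := clampCfg_mem hV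
  have hWP : ∀ (z : Site d) (i j : Fin d), ‖((hol W z (plaqWord i j) : 𝔸ˣ) : 𝔸) - 1‖ ≤ α := by
    intro z i j
    rcases eq_or_ne i j with rfl | hij
    · rw [hol_plaqWord_self]; simpa using hα
    · exact norm_hol_plaqWord_clampCfg_le hlohi V hij hα (fun z' hz' => h44 z' i j hij hz') z
  have hag : AgreeOn lo hi W V := clampCfg_agree V
  have h1 : hol V x (posWord w₁) = hol W x (posWord w₁) := (hol_posWord_congr hag w₁ x hx hend).symm
  have h2 : hol V x (posWord w₂) = hol W x (posWord w₂) :=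
    (hol_posWord_congr hag w₂ x hx (by rwa [← disp_posWord_perm hperm])).symm
  rw [h1, h2]
  exact norm_hol_posWord_perm_le hWm hα hWP w₁ w₂ hperm x

end Normed

/-! ## §5 Non-vacuity -/

section NonVacuity

open scoped Matrix.Norms.L2Operator

/-- The trivial configuration on `ℤ²` with values in `2 × 2` real matrices and the two orders of the steps `e₀, e₁`: the
area law gives `‖1·1⁻¹ − 1‖ ≤ (2 choose 2)·0 = 0`. [folklore] -/
example (x : Site 2) :
    ‖((hol (fun (_ : Site 2) (_ : Fin 2) => (1 : (Matrix (Fin 2) (Fin 2) ℝ)ˣ)) x (posWord [0, 1]) *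
        (hol (fun (_ : Site 2) (_ : Fin 2) => (1 : (Matrix (Fin 2) (Fin 2) ℝ)ˣ)) x (posWord [1, 0]))⁻¹ :
          (Matrix (Fin 2) (Fin 2) ℝ)ˣ) : Matrix (Fin 2) (Fin 2) ℝ) - 1‖ ≤ (([0, 1] : List (Fin 2)).length.choose 2 : ℕ) * 0 :=
  norm_hol_posWord_perm_le (fun _ _ => (U1 _).one_mem) le_rfl (fun z i j => by simp [hol_plaqWord_eq]) _ _
    (List.Perm.swap 1 0 []) x

end NonVacuity

end Summit.QuantumFields.BalabanUV.Beta.MonotoneLoopHolonomy
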